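import Summits.CriticalPhenomena.PercolationContinuityZ3.Theorems.Transplant.SkelNegBParamsFaceCountsA
import HarnessLib

/-!
# N1 params, M3 part 1a — **THE x-FACE RUN COUNTS ARE IN RANGE**: the along target is at least one stride ahead of the cross-shifted origin and
# at most `15r₀ + E + C` away, so `NrX + 1 ≤ 600·Kq`; the tangential target is within `kE + C₁ + 2u₁`, so `N3X + 1 ≤ 200·Kq + 10`; hence hp-8's
# schedule room `0 + 1 + NrX + 1 + N3X ≤ nFA κ.K₀ (= 2000·Kq)` and the served floors' precondition `NrX + 1 ≤ 1000·Kq` (`hfitX_RA`, `hq₃X_RA`)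
(p3-g12, M3 pen, 2026-08-22; spec HOME prim-hp-8/M3-FLOORS-SIGNATURE.md; F-COLUMN-N1-PLAN ADDENDUM 6).

The origin-reading constants `C` (`|FcA (yTX0 yL σT)| ≤ C ≤ 8u₀`) and `C₁` (`|F1cA yL| ≤ C₁ ≤ 8u₁`) are hypotheses here, discharged per landing
origin (`yLFs/yLFd/yLFt` of FramesF/F2) in part 1b; `E ≤ u₀` is the face-apron reach room (`E := RlevA + reachA ≤ 2RA′ + 4 < s₀`); `kE ≤ 5r₁` is p1-g13's
band (`hkE_RA`, FaceBandA).  The contact level hypotheses are the provider's own (`faceL − E ≤ lev ≤ faceL + E`, `j < K`).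
builds on p205010 (kernel theorem, internal audit signed; external expert review pending) — nothing in this file uses p205010; NOTHING is claimed about the node
`SamePDropOfSkeletonNeg₁` (OPEN); arithmetic only.
Lane `prim-bschramm-*`, seat `prim-bschramm-p3` (gen 12); helper file (`--supports stmt-CriticalPhenomena-4575 --as helper`).
[cite: KozmaNitzan2024, §4 Lemma 11 (p. 22), Lemma 12 (pp. 23–25)] [cite: MartineauTassion2017, §4.1]
-/

noncomputable section

open scoped Classical

namespace Summit.CriticalPhenomena.PercolationContinuityZ3.Theorems.Transplant

namespace PlanarSkeletonNeg

namespace NegB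

open Literature.Probability.Percolation Literature.Probability.LatticeModels SimpleGraph
open Literature.Probability.Percolation.KozmaNitzan.Cells (oth sgOf sgOf_sign)
open SkelConc (Consts)
open Skelφ.StepI (DataN)
open TwoAxis.Para (modulus)
open Neg

namespace KS

section Ranges

variable (κ : Consts) {V : Type} [DecidableEq V] [Countable V] {G : SimpleGraph V} [G.LocallyFinite] (Φ : PlanarSkeletonNeg G) (t : V)
  (p : unitInterval) (D : DataN V) (g f : ℕ)

/-- The face rows of axis `0` lie between `5r₀ + 10s₀ − 1` and `15r₀ − 1` (`faceL 0 j = 5r₀ + 10s₀(j+1) − 1`, `j < K`, `r₀ = K·s₀`). [folklore] -/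
theorem faceL_bounds (j : ℕ) (hj : j < (fcellsA κ Φ t p D g f).K) :
    5 * ((fcellsA κ Φ t p D g f).r 0 : ℤ) + 10 * u₀A κ Φ t p D g f - 1 ≤ (fcellsA κ Φ t p D g f).faceL 0 j ∧
      (fcellsA κ Φ t p D g f).faceL 0 j ≤ 15 * ((fcellsA κ Φ t p D g f).r 0 : ℤ) - 1 := by
  have hr : ((fcellsA κ Φ t p D g f).r 0 : ℤ) = ((fcellsA κ Φ t p D g f).K : ℤ) * u₀A κ Φ t p D g f := by
    unfold u₀A; rw [PCells2.r_eq]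
  have hu : 1 ≤ u₀A κ Φ t p D g f := (units_eqA κ Φ t p D g f).2.2.2.2.2.2.1
  have hj' : ((j + 1 : ℕ) : ℤ) ≤ ((fcellsA κ Φ t p D g f).K : ℤ) := by exact_mod_cast hj
  have hj0 : (1 : ℤ) ≤ ((j + 1 : ℕ) : ℤ) := by exact_mod_cast Nat.succ_pos j
  unfold PCells2.faceL
  have es : ((fcellsA κ Φ t p D g f).s 0 : ℤ) = u₀A κ Φ t p D g f := rfl
  rw [es, hr]
  constructor
  · nlinarith
  · nlinarith

/-- **The along target is ahead of the cross-shifted origin and bounded**: `5r₀ + 1 − E − C ≤ σ·(T0X − FcA(yTX0)) ≤ 15r₀ − 10u₀ + 1 + E + C`. [folklore] -/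
theorem along_target_bounds (x : Site 2) (du : MDir) (hd : du.1 = 0) (z : Site 2) {j E : ℕ} (hj : j < (fcellsA κ Φ t p D g f).K)
    (hlev1 : (fcellsA κ Φ t p D g f).faceL 0 j - E ≤ (fcellsA κ Φ t p D g f).lev du x z)
    (hlev2 : (fcellsA κ Φ t p D g f).lev du x z ≤ (fcellsA κ Φ t p D g f).faceL 0 j + E)
    (yL : Site 2) (σT : ℤ) {C : ℤ} (he : |FcA κ Φ t p D g f (yTX0 κ Φ t p D g f yL σT)| ≤ C) :
    5 * ((fcellsA κ Φ t p D g f).r 0 : ℤ) + 1 - E - C ≤ sgOf du * (T0X κ Φ t p D g f x du z - FcA κ Φ t p D g f (yTX0 κ Φ t p D g f yL σT)) ∧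
      sgOf du * (T0X κ Φ t p D g f x du z - FcA κ Φ t p D g f (yTX0 κ Φ t p D g f yL σT)) ≤
        15 * ((fcellsA κ Φ t p D g f).r 0 : ℤ) - 10 * u₀A κ Φ t p D g f + 1 + E + C := by
  have hT := T0X_eq κ Φ t p D g f x du hd z
  obtain ⟨f1, f2⟩ := faceL_bounds κ Φ t p D g f j hj
  have hσ : sgOf du = 1 ∨ sgOf du = -1 := sgOf_sign du
  obtain ⟨e1, e2⟩ := abs_le.1 he
  set F := FcA κ Φ t p D g f (yTX0 κ Φ t p D g f yL σT)
  have hσF : |sgOf du * F| ≤ C := by rcases hσ with h | h <;> simp [h, abs_le] <;> constructor <;> linarith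
  obtain ⟨s1, s2⟩ := abs_le.1 hσF
  rw [mul_sub, hT]
  constructor <;> linarith

/-- **THE ALONG COUNT IS IN RANGE**: the target is at least one stride ahead (the precondition of `NrX_spec`) and `NrX + 1 ≤ 600·Kq`, whenever
`E + C ≤ 8·u₀` (apron reach + origin reading ≤ eight strides). [cite: KozmaNitzan2024, §4 Lemma 11 (p. 22)] -/
theorem NrX_range (hN : EqNumL κ Φ t p D g f) (x : Site 2) (du : MDir) (hd : du.1 = 0) (z : Site 2) {j E : ℕ} (hj : j < (fcellsA κ Φ t p D g f).K)
    (hlev1 : (fcellsA κ Φ t p D g f).faceL 0 j - E ≤ (fcellsA κ Φ t p D g f).lev du x z)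
    (hlev2 : (fcellsA κ Φ t p D g f).lev du x z ≤ (fcellsA κ Φ t p D g f).faceL 0 j + E)
    (yL : Site 2) (σT : ℤ) {C : ℤ} (he : |FcA κ Φ t p D g f (yTX0 κ Φ t p D g f yL σT)| ≤ C) (hEC : (E : ℤ) + C ≤ 8 * u₀A κ Φ t p D g f) :
    u₀A κ Φ t p D g f ≤ sgOf du * (T0X κ Φ t p D g f x du z - FcA κ Φ t p D g f (yTX0 κ Φ t p D g f yL σT)) ∧
      NrX κ Φ t p D g f yL σT x du z + 1 ≤ 600 * Neg.Kq κ := by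
  obtain ⟨a1, a2⟩ := along_target_bounds κ Φ t p D g f x du hd z hj hlev1 hlev2 yL σT he
  have hu : 1 ≤ u₀A κ Φ t p D g f := (units_eqA κ Φ t p D g f).2.2.2.2.2.2.1
  have hr : ((fcellsA κ Φ t p D g f).r 0 : ℤ) = 40 * (Neg.Kq κ : ℤ) * u₀A κ Φ t p D g f := (units_eqA κ Φ t p D g f).2.2.1
  have hq : (1 : ℤ) ≤ Neg.Kq κ := by exact_mod_cast Neg.one_le_Kq κ
  have hC0 : 0 ≤ C := le_trans (abs_nonneg _) he
  set u := u₀A κ Φ t p D g f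
  set Q := (Neg.Kq κ : ℤ)
  have hQu : u ≤ Q * u := by nlinarith
  have hX : u ≤ sgOf du * (T0X κ Φ t p D g f x du z - FcA κ Φ t p D g f (yTX0 κ Φ t p D g f yL σT)) := by nlinarith
  refine ⟨hX, ?_⟩
  obtain ⟨-, r2⟩ := NrX_spec κ Φ t p D g f hN yL σT x du z hX
  have h1 : u * ((NrX κ Φ t p D g f yL σT x du z : ℤ) + 1) ≤ u * (600 * Q) := by nlinarith
  have h2 : ((NrX κ Φ t p D g f yL σT x du z : ℤ) + 1) ≤ 600 * Q := le_of_mul_le_mul_left h1 (by linarith)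
  have h3 : ((NrX κ Φ t p D g f yL σT x du z + 1 : ℕ) : ℤ) ≤ ((600 * Neg.Kq κ : ℕ) : ℤ) := by push_cast; exact h2
  exact_mod_cast h3

/-- **THE TANGENTIAL COUNT IS IN RANGE**: `N3X + 1 ≤ 200·Kq + 10` whenever the contact's transverse offset is within the band `kE ≤ 5r₁` and
the landing origin's ordinate reading is within eight strides. [folklore] -/
theorem N3X_range (yL x z : Site 2) {kE C₁ : ℤ} (hz : |z 1 - (fcellsA κ Φ t p D g f).cen x 1| ≤ kE)
    (hkE : kE ≤ 5 * ((fcellsA κ Φ t p D g f).r 1 : ℤ)) (hC1 : |F1cA κ Φ t p D g f yL| ≤ C₁) (hC1' : C₁ ≤ 8 * u₁A κ Φ t p D g f) :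
    N3X κ Φ t p D g f yL x z + 1 ≤ 200 * Neg.Kq κ + 10 := by
  obtain ⟨-, r2, -⟩ := N3X_spec κ Φ t p D g f yL x z
  have hu : 1 ≤ u₁A κ Φ t p D g f := (units_eqA κ Φ t p D g f).2.2.2.2.2.2.2
  have hr : ((fcellsA κ Φ t p D g f).r 1 : ℤ) = 40 * (Neg.Kq κ : ℤ) * u₁A κ Φ t p D g f := (units_eqA κ Φ t p D g f).2.2.2.1
  set u := u₁A κ Φ t p D g f
  set Q := (Neg.Kq κ : ℤ)
  have hT : |T1X κ Φ t p D g f x z - F1cA κ Φ t p D g f yL| ≤ kE + C₁ := by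
    unfold T1X
    calc |(fcellsA κ Φ t p D g f).cen x 1 - z 1 - F1cA κ Φ t p D g f yL|
        = |-(z 1 - (fcellsA κ Φ t p D g f).cen x 1) + -F1cA κ Φ t p D g f yL| := by ring_nf
      _ ≤ |-(z 1 - (fcellsA κ Φ t p D g f).cen x 1)| + |-F1cA κ Φ t p D g f yL| := abs_add_le _ _
      _ ≤ kE + C₁ := by rw [abs_neg, abs_neg]; exact add_le_add hz hC1
  have h1 : u * ((N3X κ Φ t p D g f yL x z : ℤ) + 1) ≤ u * (200 * Q + 10) := by nlinarith
  have h2 : ((N3X κ Φ t p D g f yL x z : ℤ) + 1) ≤ 200 * Q + 10 := le_of_mul_le_mul_left h1 (by linarith)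
  have h3 : ((N3X κ Φ t p D g f yL x z + 1 : ℕ) : ℤ) ≤ ((200 * Neg.Kq κ + 10 : ℕ) : ℤ) := by push_cast; exact h2
  exact_mod_cast h3

/-- **The counts fit the closure's budget and the served floors' precondition**: `NrX + 1 ≤ 1000·Kq`, `N3X + 1 ≤ 1000·Kq` and
`0 + 1 + NrX + 1 + N3X ≤ nFA κ.K₀` (hp-8's `hnFx`). [folklore] -/
theorem counts_budget {Nr N₃ : ℕ} (hNr : Nr + 1 ≤ 600 * Neg.Kq κ) (hN₃ : N₃ + 1 ≤ 200 * Neg.Kq κ + 10) :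
    Nr + 1 ≤ 1000 * Neg.Kq κ ∧ N₃ + 1 ≤ 1000 * Neg.Kq κ ∧ 0 + 1 + Nr + 1 + N₃ ≤ nFA κ.K₀ := by
  have hq := Neg.one_le_Kq κ
  rw [(nFA_le_LfA κ.K₀).2, LfA_eq]
  refine ⟨by omega, by omega, by omega⟩

end Ranges

end KS

end NegB

end PlanarSkeletonNeg

end Summit.CriticalPhenomena.PercolationContinuityZ3.Theorems.Transplant

end
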